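import Literature.AnabelianGeometry.EtaleTheta.TemperedFrobenioidDiagonalOfKummerTateTower
import HarnessLib

/-!
# [EtTh] Prop. 4.2 (iii) NEEDS ROOTS OF UNITY in the base-field-theoretic rational functions: the typed (iii) is FALSE at
# every §4 setting whose `B₀^Λ` is torsion-free — in particular at the v2 Kummer–Tate tower, where ERRATUM E2 HOLDS

S. Mochizuki, *The étale theta function and its Frobenioid-theoretic manifestations*, Publ. RIMS **45** (2009)
[MochizukiEtTh2009], §4: Def. 4.1 (iv)(a) PDF p.87 («`A` is `μ_N`-saturated [cf. [FrdII], Definition 2.1, (i)]», typed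
`BaseFrobeniusTypeData.isMuSaturated`), Prop. 4.2 (iii) PDF p.88 l.24–70 («α … of base-Frobenius type … of Frobenius degree
`N`»), proof PDF p.89 l.77 – p.90 l.11 [cite: MochizukiEtTh2009, Prop 4.2 (iii) p.88]; [FrdII] Def. 2.1 (i) p.16 («the abstract
group `μ_N(A)` is isomorphic to `ℤ/Nℤ`»).

abc-iut cell, layer L2, DAG node `EtTh:Prop4.2(iii)`; seat abc-iut-w6-d037 (gen 5), abc-iut-L2-lead R1011 sequel (b) «(iii) at the
Kummer–Tate tower with `hR` a THEOREM (honest scope: base `B^temp(Grp)⁰` of the tower group)».  PROOF-ONLY (no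
definitions, no instance declarations; nothing landed is edited or restated).

WHAT IS PROVED (the sequel's (M) cell is NEGATIVE, kernel-checked).
* §1, for ANY tempered Frobenioid `C` (abc-iut-L2-t3's Def. 3.6 (ii) structure) with `Φ` divisorial, at an object `X` whose
  base-field-theoretic rational functions `B₀^Λ(Base X)` are TORSION-FREE: every `σ ∈ μ_N(X)` is trivial
  (`TemperedFrobenioid.eq_one_of_mem_mu_of_pow_eq_one_imp`: `u_σ = (b₀, 1)` by [FrdI] Thm. 5.2 (ii) relation (d) and sharpness,
  `u_{σ^N} = u_σ^N`, so `b₀^N = 1`, `b₀ = 1`, `u_σ = 1`, `σ = 1` by abc-iut-L1's `ModelFrobenioid.eq_one_of_mem_units_of_unit_eq_one`);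
  hence NO object is `μ_N`-saturated for `N ≥ 2` (`not_isMuSaturated_of_pow_eq_one_imp`).
* §2, for ANY §4 setting `S` (any vocabulary, any transport `pullFrac`) over such a `C`: ONE fraction-pair at `A_⊙` already makes
  the typed Prop. 4.2 (iii) FALSE (`BiKummerSetting.not_prop42_iii_of_BΛ_torsionFree`): an `N`-th root datum for `N = 2` carries a
  base-Frobenius-type `α : A_N → A` of Frobenius degree `2` (`NthRoot.isIsometry`), whose Def. 4.1 (iv)(a) clause demands `A_N`
  `μ_2`-saturated (`BaseFrobeniusTypeData.isMuSaturated`).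
* §3, the INSTANCE OF RECORD: the v2 Kummer–Tate tower (`TateTowerKummer.tower`, every level the Tate skeleton with function group
  `Fn = ⟨ϖ⟩ × ⟨U⟩ ≅ ℤ²`, torsion-free: `TateTowerKummer.bZero_pow_eq_one_imp`) and abc-iut-w6-d058's diagonal-base tempered Frobenioid
  `TateTowerKummer.diagTemperedFrobenioid R S` over the WHOLE base `B^temp(Grp)⁰`: for EVERY choice of the §4-model data (Galois data
  `gS`, slot `NH`, Frobenius-trivial anchor `A₀`) the canonical §4 model has the fraction-pair `(𝟙, 𝟙)` for `f = 1` at `A_⊙`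
  (built inside the proof) and **`TateTowerKummer.not_prop42_iii_diag`**: Prop. 4.2 (iii) AS TYPED is FALSE there — although the
  ERRATUM E2 root law HOLDS at this tower (`TateTowerKummer.rootLaw`, `diag_baseRootLaw_top`).
So at the constructed carriers of record there is a SECOND obstruction to (iii) beside E2: print's constants contain `μ_∞(K̄)`,
ours (`ϖ^ℤ · U^ℤ`) contain no root of unity; the first positive carrier must have level functions with `μ_{N_n}`, `N_n → ∞`
(abc-iut-L2-t3's (β) Ÿ-tower).  HONEST FRAMING: a kernel fact about OUR typed carriers; nothing in [EtTh] is refuted (print's `C`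
has cyclotomic constants); [EtTh] is a refereed prerequisite paper; nothing here bears on, or takes a side on, the disputed
[IUTchIII] Cor. 3.12; nothing here asserts abc proved or refuted.
-/

noncomputable section

namespace Literature.AnabelianGeometry.EtaleTheta

open CategoryTheory Opposite Function Literature.AlgebraicGeometry.Frobenioids Literature.AnabelianGeometry.SemiGraphs
  LogDivisorModel LogDivisorTower

universe u₀ v₀ u v w

/-! ## §1 Units of a tempered Frobenioid over torsion-free `B₀^Λ` have no torsion -/

namespace TemperedFrobenioid

variable {D₀ : Type u₀} [Category.{v₀} D₀] {V : FrdIMonoidStub.{w}} {T : RealifiedDivisorMonoids (D₀ := D₀) V}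
  {D : Type u} [Category.{v} D] {VD : FrdICatStub.{u, v, w} D} (C : TemperedFrobenioid T D VD)

/-- **`μ_N(X) = 1` when `B₀^Λ(Base X)` is torsion-free** (`Φ` divisorial): for `σ ∈ O^×(X)` with `σ^N = 1`, the rational function
`u_σ = (b₀, ξ) ∈ B(X) = B₀^Λ ×_{(Φ^{ℝ-log})^gp} Φ^gp` has `ξ = Div_B(u_σ) = Div(σ) = 0` ([FrdI] Thm. 5.2 (ii) relation (d); `Φ(Base X)`
sharp) and `b₀^N = 1`, so `u_σ = 1` and `σ = (1, id, 0, 1) = id`. [cite: MochizukiEtTh2009, Def 4.1 (iv) p.87] -/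
theorem eq_one_of_mem_mu_of_pow_eq_one_imp (hΦd : Objectwise (fun M _ => IsDivisorial M) C.divisorMonoid)
    {X : C.category}
    (htf : ∀ (b : T.BΛ.obj (C.baseOp (op X.base))) (N : ℕ), 0 < N → b ^ N = 1 → b = 1)
    {N : ℕ+} {σ : Aut X} (hσ : σ ∈ C.mu X N) : σ = 1 := by
  have hu : σ ∈ ModelFrobenioid.units X := ⟨hσ.1.1, hσ.1.2⟩
  apply ModelFrobenioid.eq_one_of_mem_units_of_unit_eq_one hΦd hu
  -- `u_{σ^N} = u_σ^N` (`α ↦ u_α` is a homomorphism on `O^×(X)`)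
  have hpow : ModelFrobenioid.unit (σ ^ (N : ℕ)).hom = ModelFrobenioid.unit σ.hom ^ (N : ℕ) := by
    have h := congrArg (fun x : (C.ratFnFunctor.obj (op X.base))ˣ => (x : C.ratFnFunctor.obj (op X.base)))
      (map_pow (ModelFrobenioid.unitsToRatFn X) ⟨σ, hu⟩ (N : ℕ))
    simp only [Units.val_pow_eq_pow_val, ModelFrobenioid.coe_unitsToRatFn, Subgroup.coe_pow] at h
    exact h
  have hN : ModelFrobenioid.unit σ.hom ^ (N : ℕ) = 1 := by
    rw [← hpow, hσ.2]
    exact ModelFrobenioid.unit_id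
  -- the `Φ^gp`-component of `u_σ` is `Div(σ) = 0`
  have h2 : (ModelFrobenioid.unit σ.hom).1.2 = 1 := by
    have hrel := ModelFrobenioid.of_div_eq_divB_unit_of_mem_units hu
    rw [ModelFrobenioid.div_eq_one_of_mem_units (hΦd X.base).isSharp hu, map_one] at hrel
    exact hrel.symm
  -- the `B₀^Λ`-component is killed by `N`, hence trivial
  have h1 : (ModelFrobenioid.unit σ.hom).1.1 = 1 := by
    -- `(u_σ ^ N).1.1 = u_σ.1.1 ^ N` definitionally (submonoid and product powers are componentwise)
    have h : (ModelFrobenioid.unit σ.hom).1.1 ^ (N : ℕ) = 1 :=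
      congrArg (fun p : C.ratFnFunctor.obj (op X.base) => p.1.1) hN
    exact htf _ N N.pos h
  exact Subtype.ext (Prod.ext h1 h2)

/-- **No object over torsion-free `B₀^Λ` is `μ_N`-saturated for `N ≥ 2`** ([FrdII] Def. 2.1 (i): `μ_N(X) ≅ ℤ/Nℤ`, typed «generated by an
element of order `N`»). [cite: MochizukiEtTh2009, Def 4.1 (iv) p.87] -/
theorem not_isMuSaturated_of_pow_eq_one_imp (hΦd : Objectwise (fun M _ => IsDivisorial M) C.divisorMonoid)
    {X : C.category}
    (htf : ∀ (b : T.BΛ.obj (C.baseOp (op X.base))) (N : ℕ), 0 < N → b ^ N = 1 → b = 1)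
    {N : ℕ+} (hN : 2 ≤ (N : ℕ)) : ¬ C.IsMuSaturated X N := by
  rintro ⟨σ, hσ, hord, -⟩
  rw [C.eq_one_of_mem_mu_of_pow_eq_one_imp hΦd htf hσ, orderOf_one] at hord
  omega

end TemperedFrobenioid

/-! ## §2 Any §4 setting: one fraction-pair at `A_⊙` + torsion-free `B₀^Λ` ⇒ Prop. 4.2 (iii) is false -/

namespace BiKummerSetting

variable {K : Type u₀} [Field K] {X : SemiGraphs.TemperedArithmeticGroup.{u₀} K} {D₀ : Type u₀} [Category.{v₀} D₀]
  {V : FrdIMonoidStub.{w}} {T : RealifiedDivisorMonoids (D₀ := D₀) V} {D : Type u} [Category.{v} D]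
  {VD : FrdICatStub.{u, v, w} D} (S : BiKummerSetting X T D VD)

/-- **[EtTh] Prop. 4.2 (iii) AS TYPED is FALSE at every §4 setting over a tempered Frobenioid with torsion-free `B₀^Λ`** (`Φ`
divisorial), for EVERY transport `pullFrac`, as soon as one fraction-pair at `A_⊙` exists: a root datum for `N = 2` contains
`α : A_2 → A_⊙` of base-Frobenius type and Frobenius degree `2`, and Def. 4.1 (iv)(a) asks `A_2` to be `μ_2`-saturated — impossible by
§1. [cite: MochizukiEtTh2009, Prop 4.2 (iii) p.88] -/
theorem not_prop42_iii_of_BΛ_torsionFree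
    (pullFrac : ∀ {A A' : S.C} (_ : A' ⟶ A), S.biratUnits A → S.biratUnits A')
    (hΦd : Objectwise (fun M _ => IsDivisorial M) S.tf.divisorMonoid)
    (htf : ∀ (A : S.C) (b : T.BΛ.obj (S.tf.baseOp (op A.base))) (N : ℕ), 0 < N → b ^ N = 1 → b = 1)
    {B : S.C} {f : S.biratUnits S.Aodot} (P : S.FractionPair f B) :
    ¬ S.Prop42_iii pullFrac := by
  intro h
  obtain ⟨R⟩ := h f P 2
  have hμ : S.IsMuSaturated R.AN (S.degFr R.α) := R.αData.isMuSaturated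
  rw [R.isIsometry.2.2.1] at hμ
  exact S.tf.not_isMuSaturated_of_pow_eq_one_imp hΦd (htf R.AN) (le_refl 2) hμ

end BiKummerSetting

/-! ## §3 The instance of record: the v2 Kummer–Tate tower and its diagonal-base tempered Frobenioid -/

namespace TateTowerKummer

/-- **`B₀` of the Kummer–Tate tower is torsion-free**: `B₀(Y) = Hom_Γ(Y, Mero(Z_∞^{(lvl Y)}))` with `Mero = ⟨ϖ⟩ × ⟨U⟩ ≅ ℤ²` at every level
(`TateTower.model`), so `b^N = 1`, `N ≥ 1`, forces `b = 1` pointwise (`pow_injective_fn`). [cite: MochizukiEtTh2009, Def 3.3 (iii) p.73] -/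
theorem bZero_pow_eq_one_imp (Y : ConnectedPart (BTemp Grp)) (b : (tower.act (levels.lvl Y)).bZero (gset Y)) (N : ℕ)
    (hN : 0 < N) (h : b ^ N = 1) : b = 1 := by
  apply Subtype.ext
  funext s
  -- `(b ^ N).1 s = (b.1 s) ^ N` definitionally (subgroup and `Pi` powers are pointwise)
  have hs : b.1 s ^ N = 1 := congrArg (fun c : (tower.act (levels.lvl Y)).bZero (gset Y) => c.1 s) h
  exact pow_injective_fn hN (hs.trans (one_pow N).symm)

variable (R S : ((ConnectedPart (BTemp Grp))ᵒᵖ ⥤ CommMonCat.{0}) → Prop)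
  {K : Type 1} [Field K] (X : SemiGraphs.TemperedArithmeticGroup.{1} K)
  (gS : ∀ A : ConnectedPart (BTemp Grp), True → (X.Pi →* Aut A))
  (gSs : ∀ (A : ConnectedPart (BTemp Grp)) (h : True), Function.Surjective (gS A h))
  (NH : Subgroup (Field.absoluteGaloisGroup K) → (diagTemperedFrobenioid R S).category → ℕ+ → Prop)
  (A₀ : (diagTemperedFrobenioid R S).category) (hA₀ : PreFrobenioid.IsFrobeniusTrivial (diagTemperedFrobenioid R S).toElem A₀)

/-- **[EtTh] Prop. 4.2 (iii) AS TYPED is FALSE at the v2 Kummer–Tate tower** — for the canonical §4 model over abc-iut-w6-d058's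
diagonal-base tempered Frobenioid `diagTemperedFrobenioid R S` (whole base `B^temp(Grp)⁰`, genuine transport `pullFracModel`) and EVERY
choice of Galois data `gS`, slot `NH` and Frobenius-trivial anchor `A_⊙`: Def. 4.1 (i) is inhabited there by the trivial fraction-pair
`(id, id) : A_⊙ → A_⊙` for `f = 1` (`Div(id) = 0`; `Φ(A_⊙^bs)` divisorial, hence sharp), but no `μ_2`-saturated `2`-domain exists
(§1–§2, `bZero_pow_eq_one_imp`) — although the ERRATUM E2 root law HOLDS here (`TateTowerKummer.rootLaw`, `diag_baseRootLaw_top`).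
The (M) cell of node `EtTh:Prop4.2(iii)` at this carrier is therefore NEGATIVE: roots of UNITY, not only roots of functions, are
needed. [cite: MochizukiEtTh2009, Prop 4.2 (iii) p.88] -/
theorem not_prop42_iii_diag :
    ¬ (BiKummerSetting.mkOfModelCanonical X (diagTemperedFrobenioid R S) rfl (diag_hP R S) (fun _ => True) gS gSs NH A₀ hA₀
        trivial).Prop42_iii (fun {_ _} φ x => (diagTemperedFrobenioid R S).pullFracModel φ x) := by
  intro h
  -- the trivial fraction-pair `(id, id)` for `f = 1` at `A_⊙`
  have P : (BiKummerSetting.mkOfModelCanonical X (diagTemperedFrobenioid R S) rfl (diag_hP R S) (fun _ => True) gS gSs NH A₀ hA₀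
      trivial).FractionPair (A := A₀) 1 A₀ :=
    { num := 𝟙 _
      den := 𝟙 _
      isPreStep_num := ModelFrobenioid.isPreStep_id _
      isPreStep_den := ModelFrobenioid.isPreStep_id _
      base_eq := rfl
      frac_eq := ModelFrobenioid.frac_self _ _
      disjointSupports := fun x hx _ =>
        ((diagTemperedFrobenioid R S).isDivisorial_divisorMonoid A₀.base).isSharp.eq_one_of_isUnit x (isUnit_of_dvd_one hx) }
  exact BiKummerSetting.not_prop42_iii_of_BΛ_torsionFree
    (BiKummerSetting.mkOfModelCanonical X (diagTemperedFrobenioid R S) rfl (diag_hP R S) (fun _ => True) gS gSs NH A₀ hA₀ trivial)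
    (fun {_ _} φ x => (diagTemperedFrobenioid R S).pullFracModel φ x)
    (diagTemperedFrobenioid R S).isDivisorial_divisorMonoid (fun A b N hN hb => bZero_pow_eq_one_imp A.base b N hN hb) P h

end TateTowerKummer

end Literature.AnabelianGeometry.EtaleTheta

end
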